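import Literature.Probability.RandomPlanarGeometry.SAWPulledLargeForceExpansionConvergence
import HarnessLib

/-!
# The pulled self-avoiding walk on `ℤ^{d+1}` at large force, EVERY dimension: Kesten's equation in the expansion
# variables and the CONVERGENT large-force expansion of `e^{λ_B(y)}` with integer coefficients

Topic `Literature/Probability/RandomPlanarGeometry` (uses `SAWPulledLargeForceExpansionConvergence.lean` and, through it,
`SAWPulledLargeForceExpansion.lean`: the generic cost-series engine `CostSeries.*` (`P`, `A`, `E`, `a`, `ev`, `abs_sub_ev_A_le_half_pow`,
`coeff_A_eq_a`, `abs_coeff_E_le`); `SAWPulledRenewalGap.lean` / `SAWPulledRenewalIdentity.lean`: the renewal objects `Λ_i(y) = pulledIrrZ`,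
`p_i(y) = pulledBlockLaw`, `a_n(y) = pulledAmp`, `pulledAmp_renewal`, `pulledAmp_mul_pow_unbounded`, `pow_le_rpow_two_thirds_mul_pow`, the
`_of` compositions; `SAWIrreducibleBridgeCrossings.lean`: `three_mul_span_le`; `SAWBridgeUpperBound.lean`: `b_n ≤ μ^n`; the model-free
renewal files `Process/RenewalGeometricEnvelope.lean`).

The `ℤ²` files `SAWPulledLargeForceKestenEquation / …Expansion / …ExpansionConvergence` used the certified third-order windows of the
square lattice to discharge the renewal gap condition. Here the gap is discharged in EVERY dimension by the PLAIN envelope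
`p_i(y) ≤ y^{2/3} (y^{1/3} μ / y)^i` (three crossings `3·span ≤ i + 2`, `λ_i ≤ b_i ≤ μ^i`, `e^{-iλ_B} ≤ y^{-i}`), geometric for `y > μ³`,
so everything downstream holds on `ℤ^{d+1}` for all `d`:

* ★ `pulledGap_zd (d) (hy : μ(ℤ^{d+1})³ < y)`: the pulled Kesten relation `Σ_i Λ_i(y) e^{-iλ_B(y)} = 1`, finite mean block length, the all-`n`
  sandwich and the renewal limit — in every dimension, no certificates;
* cost grading on `ℤ^{d+1}`: `largeForceUZd d y = u(y) = y e^{-λ_B(y)}` (`≤ 1`), `costZd`, `costCoeffZd d c n = N_{c,n}`, `costCoeffZd_zero`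
  (`P_0 = X`), `costCoeffZd_le_count`, ★ `hasSum_costPoly_zd` (Kesten's equation in the expansion variables, `y > μ³`);
* generic (`CostSeries`, appended to the engine): THE inverse coefficients `e N k := [X^k] E_k`, stability `coeff_E_eq_e` (`X^{K+1} ∣ E_{K+1} − E_K`),
  `abs_e_le`, ★★★ `hasSum_e_inv` (`Σ_k e_k t^k = 1/u(t)` for `0 < t ≤ min t₀ (1/(400ρ(B+1)))` — the inverse expansion converges, using only the
  generic uniform contraction), `e_zero`;
* ★★★★ **`hasSum_largeForceCoeffZd (d) : ∀ y ≥ 1/t*_d, HasSum (fun k => y · (c^{(d)}_k · y⁻¹^k)) (e^{λ_B(y)})`** on `ℤ^{d+1}`, with the integer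
  coefficients `largeForceCoeffZd d k := e (costCoeffZd d) k`, `largeForceCoeffZd_zero` (`c^{(d)}_0 = 1`), `exp_pulledBridgeFreeEnergy_eq_tsum_zd`;
  explicit `tZeroZd d = 1/(μ³ + 1)`, `tStarZd d = min tZeroZd (1/(400·(2κ²)·(2κ+1)))`, `κ = c_1(ℤ^{d+1})`.

For `d + 1 = 2` the coefficients `c^{(1)}_k` ARE `Zd.largeForceCoeff k` of the `ℤ²` files, definitionally (`largeForceCoeffZd_one`,
by `rfl` — observed by the lane referee a-ref-1 g54), so the certified values of the `ℤ²` chain are values of `c^{(1)}_k`. Printed status: first order only (Janse van Rensburg–Whittington 2013,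
§3.2 Theorem 8, `ℤ^d`). Provenance: lane «pcv-sawmu», a-p3 g15 (2026-08-24). PURE STD, no data.
-/

noncomputable section

open Finset Filter Topology
open scoped BigOperators
open Literature.Probability.LatticeModels
open Literature.Probability.RandomPlanarGeometry.SAW

namespace Literature.Probability.RandomPlanarGeometry.SAW.Zd

/-! ### The pulled Kesten relation on `ℤ^{d+1}` for `y > μ³` (plain envelope, no dimension-specific input) -/

/-- `λ_B(y) ≥ log y` on `ℤ^{d+1}` (the one-step bridge): `Z^B_1(y) = y`. [cite: Beaton2015, §3, Lemma 2] -/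
theorem log_le_pulledBridgeFreeEnergy_zd (d : ℕ) {y : ℝ} (hy : 0 < y) :
    Real.log y ≤ pulledBridgeFreeEnergy (d + 1) y := by
  have h := log_div_le_pulledBridgeFreeEnergy d hy (N := 1) le_rfl
  have h1 : pulledBridgeZ (d + 1) 1 y = y := by
    rw [pulledBridgeZ_eq_sum_bridges, bridges_one, Finset.sum_singleton]
    simp [straightWalk]
  simpa [h1] using h

/-- `e^{-iλ_B(y)} ≤ y^{-i}`. [cite: Beaton2015, §3, Lemma 2] -/
theorem exp_neg_mul_pulledBridgeFreeEnergy_le_zd (d : ℕ) {y : ℝ} (hy : 0 < y) (i : ℕ) :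
    Real.exp (-(i : ℝ) * pulledBridgeFreeEnergy (d + 1) y) ≤ (y ^ i)⁻¹ := by
  have h1 : y ^ i ≤ Real.exp ((i : ℝ) * pulledBridgeFreeEnergy (d + 1) y) := by
    calc y ^ i = Real.exp (Real.log y) ^ i := by rw [Real.exp_log hy]
      _ = Real.exp ((i : ℝ) * Real.log y) := by rw [← Real.exp_nat_mul]
      _ ≤ Real.exp ((i : ℝ) * pulledBridgeFreeEnergy (d + 1) y) :=
          Real.exp_le_exp.2 (mul_le_mul_of_nonneg_left (log_le_pulledBridgeFreeEnergy_zd d hy) (Nat.cast_nonneg i))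
  rw [neg_mul, Real.exp_neg]
  exact inv_anti₀ (pow_pos hy i) h1

/-- **Plain geometric envelope of the block law on `ℤ^{d+1}`**: for `y ≥ 1`,
`p_i(y) ≤ y^{2/3} · (y^{1/3} μ / y)^i` (three crossings `3·span ≤ i + 2`, `λ_i ≤ b_i ≤ μ^i`, `e^{-iλ_B} ≤ y^{-i}`).
[cite: MadrasSlade1993, §4.2, (4.2.21)–(4.2.22) (p. 94, 2013 reprint)] -/
theorem pulledBlockLaw_le_geometric_zd (d : ℕ) {y : ℝ} (hy : 1 ≤ y) (i : ℕ) :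
    pulledBlockLaw (d + 1) y i ≤
      y ^ (2 / 3 : ℝ) * (y ^ (1 / 3 : ℝ) * connectiveConstant (d + 1) / y) ^ i := by
  have hy0 : 0 < y := by linarith
  set μ := connectiveConstant (d + 1) with hμ
  have hμ0 : 0 < μ := connectiveConstant_pos (d + 1)
  -- Λ_i(y) ≤ μ^i · y^{2/3} (y^{1/3})^i
  have hΛ : pulledIrrZ (d + 1) i y ≤ (μ ^ i) * (y ^ (2 / 3 : ℝ) * (y ^ (1 / 3 : ℝ)) ^ i) := by
    unfold pulledIrrZ
    calc ∑ ω ∈ irreducibleBridges (d + 1) i, y ^ (ω i 0).toNat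
        ≤ ∑ ω ∈ irreducibleBridges (d + 1) i, y ^ (2 / 3 : ℝ) * (y ^ (1 / 3 : ℝ)) ^ i :=
          Finset.sum_le_sum fun ω hω => pow_le_rpow_two_thirds_mul_pow hy (three_mul_span_le hω)
      _ = (irreducibleBridgeCount (d + 1) i : ℝ) * (y ^ (2 / 3 : ℝ) * (y ^ (1 / 3 : ℝ)) ^ i) := by
          rw [Finset.sum_const, nsmul_eq_mul, irreducibleBridgeCount]
      _ ≤ (μ ^ i) * (y ^ (2 / 3 : ℝ) * (y ^ (1 / 3 : ℝ)) ^ i) := by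
          refine mul_le_mul_of_nonneg_right ?_ (by positivity)
          calc (irreducibleBridgeCount (d + 1) i : ℝ) ≤ bridgeCount (d + 1) i := by
                exact_mod_cast irreducibleBridgeCount_le_bridgeCount i
            _ ≤ μ ^ i := bridgeCount_le_pow i
  have hE := exp_neg_mul_pulledBridgeFreeEnergy_le_zd d hy0 i
  unfold pulledBlockLaw
  calc pulledIrrZ (d + 1) i y * Real.exp (-(i : ℝ) * pulledBridgeFreeEnergy (d + 1) y)
      ≤ (μ ^ i) * (y ^ (2 / 3 : ℝ) * (y ^ (1 / 3 : ℝ)) ^ i) * (y ^ i)⁻¹ :=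
        mul_le_mul hΛ hE (Real.exp_pos _).le (by positivity)
    _ = y ^ (2 / 3 : ℝ) * (y ^ (1 / 3 : ℝ) * μ / y) ^ i := by
        rw [div_pow, mul_pow, ← inv_pow]; ring

/-- For `y > μ³` the envelope ratio `y^{1/3} μ / y` is `< 1`. [cite: MadrasSlade1993, §4.2, (4.2.22)] -/
theorem envelopeRatio_lt_one_zd (d : ℕ) {y : ℝ} (hy : connectiveConstant (d + 1) ^ 3 < y) :
    y ^ (1 / 3 : ℝ) * connectiveConstant (d + 1) / y < 1 := by
  set μ := connectiveConstant (d + 1) with hμ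
  have hμ1 : 1 ≤ μ := one_le_connectiveConstant (d + 1)
  have hy1 : 1 < y := lt_of_le_of_lt (by nlinarith [one_le_pow₀ (M₀ := ℝ) hμ1 (n := 3)]) hy
  have hy0 : 0 < y := by linarith
  -- y^{1/3} > μ ≥ 1, hence y^{1/3} μ < y^{1/3} y^{1/3} ≤ y^{1/3} y^{1/3} y^{1/3} = y
  have hcube : (y ^ (1 / 3 : ℝ)) ^ 3 = y := by
    rw [← Real.rpow_natCast (y ^ (1 / 3 : ℝ)) 3, ← Real.rpow_mul hy0.le]; norm_num
  have h3 : μ < y ^ (1 / 3 : ℝ) := by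
    have : μ ^ 3 < (y ^ (1 / 3 : ℝ)) ^ 3 := by rw [hcube]; exact hy
    exact lt_of_pow_lt_pow_left₀ 3 (by positivity) this
  have hc1 : 1 ≤ y ^ (1 / 3 : ℝ) := Real.one_le_rpow hy1.le (by norm_num)
  rw [div_lt_one hy0]
  calc y ^ (1 / 3 : ℝ) * μ < y ^ (1 / 3 : ℝ) * y ^ (1 / 3 : ℝ) := mul_lt_mul_of_pos_left h3 (by positivity)
    _ ≤ y ^ (1 / 3 : ℝ) * y ^ (1 / 3 : ℝ) * y ^ (1 / 3 : ℝ) := le_mul_of_one_le_right (by positivity) hc1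
    _ = (y ^ (1 / 3 : ℝ)) ^ 3 := by ring
    _ = y := hcube

/-- ★ **The renewal gap on `ℤ^{d+1}` at large force, every dimension**: for `y > μ(ℤ^{d+1})³`, the pulled Kesten relation
`Σ_i Λ_i(y) e^{-iλ_B(y)} = 1`, a finite mean block length, the all-`n` sandwich and the renewal limit — from the PLAIN envelope
(`Renewal.hasSum_f_one_of_envelope`), no dimension-specific combinatorics. [cite: Beaton2015, Lemma 2; MadrasSlade1993, Theorem 4.2.2 (b)] -/
theorem pulledGap_zd (d : ℕ) {y : ℝ} (hy : connectiveConstant (d + 1) ^ 3 < y) :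
    HasSum (pulledBlockLaw (d + 1) y) 1 ∧ (Summable fun i : ℕ => (i : ℝ) * pulledBlockLaw (d + 1) y i)
    ∧ (∀ n : ℕ, 2 - pulledMeanBlock (d + 1) y ≤ pulledAmp (d + 1) y n ∧ pulledAmp (d + 1) y n ≤ 1)
    ∧ Tendsto (pulledAmp (d + 1) y) atTop (𝓝 (pulledMeanBlock (d + 1) y)⁻¹) := by
  have hμ1 : 1 ≤ connectiveConstant (d + 1) := one_le_connectiveConstant (d + 1)
  have hy1 : 1 ≤ y := le_of_lt (lt_of_le_of_lt (by nlinarith [one_le_pow₀ (M₀ := ℝ) hμ1 (n := 3)]) hy)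
  have hy0 : 0 < y := by linarith
  have hr1 := envelopeRatio_lt_one_zd d hy
  have hr0 : 0 < y ^ (1 / 3 : ℝ) * connectiveConstant (d + 1) / y := by
    have := connectiveConstant_pos (d + 1); positivity
  have henv := pulledBlockLaw_le_geometric_zd d hy1
  have hK : HasSum (pulledBlockLaw (d + 1) y) 1 :=
    Literature.Probability.Process.Renewal.hasSum_f_one_of_envelope (pulledAmp_zero d y)
      (pulledAmp_nonneg d hy0) (pulledAmp_le_one d hy0) (pulledBlockLaw_nonneg hy0.le) (pulledBlockLaw_zero y)
      (fun n hn => pulledAmp_renewal d y n hn) hr0 hr1 henv (fun s hs M => pulledAmp_mul_pow_unbounded d hy0 hs M)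
  have hM : Summable fun i : ℕ => (i : ℝ) * pulledBlockLaw (d + 1) y i :=
    Literature.Probability.Process.Renewal.summable_mul_f_of_envelope (pulledBlockLaw_nonneg hy0.le) hr0 hr1 henv
  exact ⟨hK, hM, two_sub_pulledMeanBlock_le_pulledAmp_of d hy0 hK hM, tendsto_pulledAmp_of d hy0 hK hM⟩

/-! ### The cost grading and Kesten's equation in the expansion variables, every dimension -/

/-- The expansion variable on `ℤ^{d+1}`: `u(y) = y e^{-λ_B(y)}`. [cite: JansevanRensburgWhittington2013, §3.2 Theorem 8 (arXiv v4 p. 11)] -/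
def largeForceUZd (d : ℕ) (y : ℝ) : ℝ := y * Real.exp (-pulledBridgeFreeEnergy (d + 1) y)

/-- `0 < u(y)`. [cite: JansevanRensburgWhittington2013, §3.2 Theorem 8 (arXiv v4 p. 11)] -/
theorem largeForceUZd_pos (d : ℕ) {y : ℝ} (hy : 0 < y) : 0 < largeForceUZd d y := mul_pos hy (Real.exp_pos _)

/-- `u(y) ≤ 1` (`λ_B ≥ log y`). [cite: JansevanRensburgWhittington2013, §3.2 Theorem 8 (arXiv v4 p. 11)] -/
theorem largeForceUZd_le_one (d : ℕ) {y : ℝ} (hy : 0 < y) : largeForceUZd d y ≤ 1 := by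
  have h := exp_neg_mul_pulledBridgeFreeEnergy_le_zd d hy 1
  simp only [Nat.cast_one, pow_one] at h
  unfold largeForceUZd
  calc y * Real.exp (-pulledBridgeFreeEnergy (d + 1) y) ≤ y * y⁻¹ :=
        mul_le_mul_of_nonneg_left (by simpa [neg_mul] using h) hy.le
    _ = 1 := mul_inv_cancel₀ hy.ne'

/-- `e^{λ_B(y)} = y / u(y)`. [cite: JansevanRensburgWhittington2013, §3.2 Theorem 8 (arXiv v4 p. 11)] -/
theorem exp_pulledBridgeFreeEnergy_eq_div_zd (d : ℕ) {y : ℝ} (hy : 0 < y) :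
    Real.exp (pulledBridgeFreeEnergy (d + 1) y) = y / largeForceUZd d y := by
  rw [largeForceUZd, Real.exp_neg]; field_simp

/-- The cost of a bridge of length `i` on `ℤ^{d+1}`: `i − span`. [cite: MadrasSlade1993, §4.2, eq. (4.2.20)–(4.2.22) (p. 94, 2013 reprint)] -/
def costZd (d i : ℕ) (ω : ℕ → Site (d + 1)) : ℕ := i - (ω i 0).toNat

/-- `2i ≤ 3·cost + 2` and `span ≤ i` for irreducible bridges on `ℤ^{d+1}`. [cite: MadrasSlade1993, §4.2, eq. (4.2.20)–(4.2.22) (p. 94, 2013 reprint)] -/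
theorem span_le_and_cost_bound_zd {d i : ℕ} {ω : ℕ → Site (d + 1)} (hω : ω ∈ irreducibleBridges (d + 1) i) :
    (ω i 0).toNat ≤ i ∧ 2 * i ≤ 3 * costZd d i ω + 2 := by
  have h3 := three_mul_span_le hω
  have hi : 1 ≤ i := (mem_irreducibleBridges.1 hω).2.1
  unfold costZd
  omega

open Classical in
/-- `N_{c,n}` on `ℤ^{d+1}`: the number of irreducible bridges of length `n` and cost `c`. [cite: MadrasSlade1993, §4.2, eq. (4.2.20)–(4.2.22) (p. 94, 2013 reprint)] -/
def costCoeffZd (d c n : ℕ) : ℕ := ((irreducibleBridges (d + 1) n).filter fun ω => costZd d n ω = c).card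

/-- `N_{c,n} = 0` unless `2n ≤ 3c + 2`. [cite: MadrasSlade1993, §4.2, eq. (4.2.20)–(4.2.22) (p. 94, 2013 reprint)] -/
theorem costCoeffZd_eq_zero_of_lt {d c n : ℕ} (h : 3 * c + 2 < 2 * n) : costCoeffZd d c n = 0 := by
  classical
  rw [costCoeffZd, Finset.card_eq_zero, Finset.filter_eq_empty_iff]
  intro ω hω hc
  have := (span_le_and_cost_bound_zd hω).2
  omega

/-- `N_{c,n} = 0` unless `c ≤ n`. [cite: MadrasSlade1993, §4.2, eq. (4.2.20)–(4.2.22) (p. 94, 2013 reprint)] -/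
theorem costCoeffZd_eq_zero_of_lt' {d c n : ℕ} (h : n < c) : costCoeffZd d c n = 0 := by
  classical
  rw [costCoeffZd, Finset.card_eq_zero, Finset.filter_eq_empty_iff]
  intro ω _ hc
  have : costZd d n ω ≤ n := Nat.sub_le _ _
  omega

/-- `N_{c,n} ≤ c_n`. [cite: MadrasSlade1993, §1.2] -/
theorem costCoeffZd_le_count (d c n : ℕ) : costCoeffZd d c n ≤ count (d + 1) n := by
  classical
  calc costCoeffZd d c n ≤ (irreducibleBridges (d + 1) n).card := Finset.card_filter_le _ _
    _ ≤ bridgeCount (d + 1) n := irreducibleBridgeCount_le_bridgeCount n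
    _ ≤ count (d + 1) n := bridgeCount_le_count n

/-- `P_0(u) = u` in every dimension. [cite: MadrasSlade1993, §4.2, eq. (4.2.20)–(4.2.22) (p. 94, 2013 reprint)] -/
theorem costCoeffZd_zero (d n : ℕ) : costCoeffZd d 0 n = if n = 1 then 1 else 0 := by
  classical
  split_ifs with h
  · subst h
    rw [costCoeffZd, irreducibleBridges_one, bridges_one, Finset.filter_singleton]
    simp [costZd, straightWalk]
  · rcases Nat.lt_or_ge 1 n with h1 | h1
    · exact costCoeffZd_eq_zero_of_lt (by omega)
    · interval_cases n
      · rw [costCoeffZd, Finset.card_eq_zero, Finset.filter_eq_empty_iff]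
        intro ω hω
        exact absurd (mem_irreducibleBridges.1 hω).2.1 (by norm_num)
      · exact absurd rfl h

/-- The block law split by cost on `ℤ^{d+1}`. [cite: Beaton2015, §3, Lemma 1, eq. (7)] -/
theorem pulledBlockLaw_eq_sum_costCoeffZd (d : ℕ) {y : ℝ} (hy : 0 < y) (i : ℕ) :
    pulledBlockLaw (d + 1) y i = ∑ c ∈ Finset.range (i + 1), (costCoeffZd d c i : ℝ) * largeForceUZd d y ^ i / y ^ c := by
  classical
  have hterm : pulledBlockLaw (d + 1) y i = ∑ ω ∈ irreducibleBridges (d + 1) i, largeForceUZd d y ^ i / y ^ costZd d i ω := by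
    rw [pulledBlockLaw, pulledIrrZ, Finset.sum_mul]
    refine Finset.sum_congr rfl fun ω hω => ?_
    have hs := (span_le_and_cost_bound_zd hω).1
    have hu : largeForceUZd d y ^ i = y ^ i * Real.exp (-(i : ℝ) * pulledBridgeFreeEnergy (d + 1) y) := by
      rw [largeForceUZd, mul_pow, ← Real.exp_nat_mul]; congr 2; ring
    rw [hu, costZd, eq_div_iff (pow_ne_zero _ hy.ne'), mul_right_comm, ← pow_add, Nat.add_sub_cancel' hs]
  rw [hterm, ← Finset.sum_fiberwise_of_maps_to (g := fun ω => costZd d i ω) (t := Finset.range (i + 1))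
      (fun ω _ => Finset.mem_range.2 (Nat.lt_succ_of_le (Nat.sub_le _ _)))]
  refine Finset.sum_congr rfl fun c _ => ?_
  rw [Finset.sum_congr rfl (fun ω hω => by rw [(Finset.mem_filter.1 hω).2]), Finset.sum_const, nsmul_eq_mul, costCoeffZd,
    mul_div_assoc]

/-- ★ **Kesten's equation in the expansion variables on `ℤ^{d+1}`, every dimension**: for `y > μ³`,
`Σ_c y^{-c} P_c(u(y)) = 1` with `P_c(u) = Σ_n N_{c,n} uⁿ`. [cite: Beaton2015, Lemma 2; MadrasSlade1993, §4.2, eq. (4.2.15)–(4.2.16) (p. 93, 2013 reprint)] -/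
theorem hasSum_costPoly_zd (d : ℕ) {y : ℝ} (hy : connectiveConstant (d + 1) ^ 3 < y) :
    HasSum (fun c : ℕ => (∑ n ∈ Finset.range (2 * c + 2), (costCoeffZd d c n : ℝ) * largeForceUZd d y ^ n) / y ^ c) 1 := by
  have hμ1 : 1 ≤ connectiveConstant (d + 1) := one_le_connectiveConstant (d + 1)
  have hy0 : 0 < y := lt_of_le_of_lt (by positivity) hy
  set u := largeForceUZd d y with hu
  have hu0 : 0 ≤ u := (largeForceUZd_pos d hy0).le
  set F : ℕ × ℕ → ℝ := fun p => (costCoeffZd d p.2 p.1 : ℝ) * u ^ p.1 / y ^ p.2 with hF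
  have hF0 : ∀ p, 0 ≤ F p := fun p => by positivity
  have hrow : ∀ i, HasSum (fun c => F (i, c)) (pulledBlockLaw (d + 1) y i) := by
    intro i
    rw [pulledBlockLaw_eq_sum_costCoeffZd d hy0 i]
    refine hasSum_sum_of_ne_finset_zero fun c hc => ?_
    have hc' : i < c := by simpa [Finset.mem_range, Nat.lt_succ_iff] using hc
    simp [hF, costCoeffZd_eq_zero_of_lt' hc']
  have hK := (pulledGap_zd d hy).1
  have hsum : Summable F := by
    refine (summable_prod_of_nonneg hF0).2 ⟨fun i => (hrow i).summable, ?_⟩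
    simpa [fun i => (hrow i).tsum_eq] using hK.summable
  have hF1 : HasSum F 1 := by
    have h := hsum.hasSum
    have h' : HasSum (pulledBlockLaw (d + 1) y) (∑' p, F p) := h.prod_fiberwise hrow
    rwa [h'.unique hK] at h
  have hG : HasSum (fun q : ℕ × ℕ => F (q.2, q.1)) 1 := by
    have := (Equiv.prodComm ℕ ℕ).hasSum_iff.2 hF1
    exact this
  refine hG.prod_fiberwise fun c => ?_
  rw [Finset.sum_div]
  refine hasSum_sum_of_ne_finset_zero fun i hi => ?_
  have hi' : 2 * c + 2 ≤ i := by simpa [Finset.mem_range] using hi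
  simp [hF, costCoeffZd_eq_zero_of_lt (show 3 * c + 2 < 2 * i by omega)]

/-! ### Generic: stability of the inverse coefficients and the convergent inverse expansion -/

namespace CostSeries

variable (N : ℕ → ℕ → ℕ)

/-! Local private copies of elementary lemmas of the sibling files (private there). -/

/-- `ev (Pz c) = P_c`. [folklore] -/
private theorem ev_PzZ (c : ℕ) (x : ℝ) : ev (Pz N c) x = P N c x := by
  simp [ev, Pz, P, map_sum]

/-- `A_0 = 1`. [folklore] -/
private theorem ev_A_zeroZ (t : ℝ) : ev (A N 0) t = 1 := by simp [ev, A]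

/-- Evaluation of the recursion `A_{K+1} = 1 − Σ_{c=1}^{K+1} X^c P_c(A_K)`. [folklore] -/
private theorem ev_A_succZ (K : ℕ) (t : ℝ) :
    ev (A N (K + 1)) t = 1 - ∑ j ∈ Finset.range (K + 1), t ^ (j + 1) * P N (j + 1) (ev (A N K) t) := by
  have h : ∀ j, ev (Polynomial.X ^ (j + 1) * (Pz N (j + 1)).comp (A N K)) t = t ^ (j + 1) * P N (j + 1) (ev (A N K) t) := by
    intro j
    rw [← ev_PzZ N (j + 1)]
    simp [ev, Polynomial.aeval_comp]
  show ev (1 - ∑ j ∈ Finset.range (K + 1), Polynomial.X ^ (j + 1) * (Pz N (j + 1)).comp (A N K)) t = _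
  simp only [ev, map_sub, map_one, map_sum]
  congr 1
  exact Finset.sum_congr rfl fun j _ => h j

/-- `P_c` is bounded by `Σ_n N_{c,n}` on `[0,1]`. [folklore] -/
private theorem P_le_sumZ {c : ℕ} {x : ℝ} (h0 : 0 ≤ x) (h1 : x ≤ 1) :
    P N c x ≤ ∑ n ∈ Finset.range (2 * c + 2), (N c n : ℝ) := by
  unfold P
  refine Finset.sum_le_sum fun n _ => ?_
  have : x ^ n ≤ 1 := pow_le_one₀ h0 h1
  have hN : (0 : ℝ) ≤ N c n := by positivity
  nlinarith

/-- `Σ_{j<n} q^j ≤ 2` for `0 ≤ q ≤ 1/2`. [folklore] -/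
private theorem geom_sum_le_twoZ {q : ℝ} (hq0 : 0 ≤ q) (hq : q ≤ 1 / 2) : ∀ n : ℕ, ∑ j ∈ Finset.range n, q ^ j ≤ 2
  | 0 => by simp
  | n + 1 => by
    rw [Finset.sum_range_succ']
    simp only [pow_succ, pow_zero]
    have ih := geom_sum_le_twoZ hq0 hq n
    have : ∑ j ∈ Finset.range n, q ^ j * q = (∑ j ∈ Finset.range n, q ^ j) * q := by rw [Finset.sum_mul]
    rw [this]
    nlinarith [Finset.sum_nonneg (fun j (_ : j ∈ Finset.range n) => pow_nonneg hq0 j)]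

/-- Evaluation of `E_K`. [folklore] -/
private theorem ev_EZ (K : ℕ) (t : ℝ) : ev (E N K) t = ∑ j ∈ Finset.range (K + 1), (1 - ev (A N K) t) ^ j := by
  simp [ev, E, map_sum]

/-- The high part of `E_K` is small: `|E_K(t) − Σ_{k ≤ K} [X^k]E_K t^k| ≤ 2 · (1/2)^{K+1}` for `0 ≤ t ≤ T₀/6`. [folklore] -/
private theorem abs_ev_E_sub_sum_leZ {B ρ : ℝ} (hB : 0 ≤ B) (hρ : 0 < ρ)
    (hN : ∀ c, (∑ n ∈ Finset.range (2 * c + 2), (N c n : ℝ)) ≤ B * ρ ^ c) {t : ℝ} (ht0 : 0 ≤ t)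
    (ht : t ≤ 1 / (96 * ρ * (B + 1))) (K : ℕ) :
    |ev (E N K) t - ∑ k ∈ Finset.range (K + 1), ((E N K).coeff k : ℝ) * t ^ k| ≤ 2 * (1 / 2) ^ (K + 1) := by
  have hR0 : 0 < 16 * ρ * (B + 1) := by positivity
  have hRt : 16 * ρ * (B + 1) * t ≤ 1 / 6 := by
    have := mul_le_mul_of_nonneg_left ht hR0.le
    rwa [show 16 * ρ * (B + 1) * (1 / (96 * ρ * (B + 1))) = (1 : ℝ) / 6 by field_simp; ring] at this
  have h3q : 3 * (16 * ρ * (B + 1) * t) ≤ 1 / 2 := by linarith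
  set D := (E N K).natDegree with hD
  set M := D + 1 + (K + 1) with hM
  have hev : ev (E N K) t = ∑ k ∈ Finset.range M, ((E N K).coeff k : ℝ) * t ^ k := by
    rw [ev, Polynomial.aeval_eq_sum_range' (show (E N K).natDegree < M by omega)]
    simp [zsmul_eq_mul]
  rw [hev, show M = (K + 1) + (D + 1) by omega, Finset.sum_range_add, add_sub_cancel_left]
  calc |∑ x ∈ Finset.range (D + 1), ((E N K).coeff (K + 1 + x) : ℝ) * t ^ (K + 1 + x)|
      ≤ ∑ x ∈ Finset.range (D + 1), |((E N K).coeff (K + 1 + x) : ℝ) * t ^ (K + 1 + x)| := Finset.abs_sum_le_sum_abs _ _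
    _ ≤ ∑ x ∈ Finset.range (D + 1), (1 / 2) ^ (K + 1) * (1 / 2) ^ x := by
        refine Finset.sum_le_sum fun x _ => ?_
        rw [abs_mul, abs_pow, abs_of_nonneg ht0]
        have h1 := abs_coeff_E_le N hB hρ hN K (K + 1 + x)
        calc |((E N K).coeff (K + 1 + x) : ℝ)| * t ^ (K + 1 + x)
            ≤ 3 ^ (K + 1) * (16 * ρ * (B + 1)) ^ (K + 1 + x) * t ^ (K + 1 + x) := mul_le_mul_of_nonneg_right h1 (by positivity)
          _ = (3 * (16 * ρ * (B + 1) * t)) ^ (K + 1) * (16 * ρ * (B + 1) * t) ^ x := by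
              rw [mul_pow 3, mul_pow (16 * ρ * (B + 1)) t, mul_pow (16 * ρ * (B + 1)) t, pow_add, pow_add]; ring
          _ ≤ (1 / 2) ^ (K + 1) * (1 / 2) ^ x := by
              refine mul_le_mul (pow_le_pow_left₀ (by positivity) h3q _)
                (pow_le_pow_left₀ (by positivity) (by linarith) _) (by positivity) (by positivity)
    _ = (1 / 2) ^ (K + 1) * ∑ x ∈ Finset.range (D + 1), (1 / 2 : ℝ) ^ x := by rw [Finset.mul_sum]
    _ ≤ (1 / 2) ^ (K + 1) * 2 := mul_le_mul_of_nonneg_left (geom_sum_le_twoZ (by norm_num) le_rfl (D + 1)) (by positivity)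
    _ = 2 * (1 / 2) ^ (K + 1) := by ring

/-- THE inverse coefficients: `e_k := [X^k] E_k` (`= c_k` for the pulled walk on `ℤ²`). [folklore] -/
def e (k : ℕ) : ℤ := (E N k).coeff k

/-- `(1 − A_K)^j` has no coefficient below `j` (`A_K(0) = 1`). [folklore] -/
private theorem X_pow_dvd_one_sub_A_pow (K j : ℕ) : Polynomial.X ^ j ∣ (1 - A N K) ^ j := by
  refine pow_dvd_pow_of_dvd ?_ j
  rw [Polynomial.X_dvd_iff, Polynomial.coeff_sub, Polynomial.coeff_one_zero, sub_eq_zero, Polynomial.coeff_zero_eq_eval_zero]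
  -- A_K(0) = 1
  induction K with
  | zero => simp [A]
  | succ K ih => simp [A, Polynomial.eval_finsetSum]

/-- `X^{K+1} ∣ E_{K+1} − E_K`. [folklore] -/
private theorem X_pow_dvd_E_succ_sub (K : ℕ) : Polynomial.X ^ (K + 1) ∣ E N (K + 1) - E N K := by
  -- E_{K+1} − E_K = Σ_{j≤K} [(1−A_{K+1})^j − (1−A_K)^j] + (1−A_{K+1})^{K+1}
  have hA : Polynomial.X ^ (K + 1) ∣ A N (K + 1) - A N K := by
    -- stability of A (re-derived from `coeff_A_eq_a`): all coefficients below K+1 agree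
    rw [Polynomial.X_pow_dvd_iff]
    intro k hk
    rw [Polynomial.coeff_sub, coeff_A_eq_a N (show k ≤ K + 1 by omega), coeff_A_eq_a N (show k ≤ K by omega), sub_self]
  have hj : ∀ j, Polynomial.X ^ (K + 1) ∣ (1 - A N (K + 1)) ^ j - (1 - A N K) ^ j := by
    intro j
    have h1 : (1 - A N (K + 1)) - (1 - A N K) ∣ (1 - A N (K + 1)) ^ j - (1 - A N K) ^ j := sub_dvd_pow_sub_pow _ _ j
    have h2 : (1 - A N (K + 1)) - (1 - A N K) = -(A N (K + 1) - A N K) := by ring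
    rw [h2] at h1
    exact dvd_trans ((dvd_neg.2 hA)) h1
  have hsplit : E N (K + 1) - E N K =
      ∑ j ∈ Finset.range (K + 1), ((1 - A N (K + 1)) ^ j - (1 - A N K) ^ j) + (1 - A N (K + 1)) ^ (K + 1) := by
    unfold E
    rw [Finset.sum_range_succ, Finset.sum_sub_distrib]
    ring
  rw [hsplit]
  exact dvd_add (Finset.dvd_sum fun j _ => hj j) (X_pow_dvd_one_sub_A_pow N (K + 1) (K + 1))

/-- Stability of the inverse coefficients: `[X^k] E_K = e_k` for `k ≤ K`. [cite: JansevanRensburgWhittington2013, §3.2 Theorem 8 (arXiv v4 p. 11)] -/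
theorem coeff_E_eq_e {k K : ℕ} (hk : k ≤ K) : (E N K).coeff k = e N k := by
  induction K with
  | zero => obtain rfl : k = 0 := Nat.le_zero.1 hk; rfl
  | succ K ih =>
    rcases Nat.lt_or_ge k (K + 1) with h | h
    · have hd := (Polynomial.X_pow_dvd_iff.1 (X_pow_dvd_E_succ_sub N K)) k h
      rw [Polynomial.coeff_sub, sub_eq_zero] at hd
      rw [hd, ih (by omega)]
    · obtain rfl : k = K + 1 := le_antisymm hk h; rfl

/-- Geometric bound on THE inverse coefficients: `|e_k| ≤ 3^{k+1}(16ρ(B+1))^k`. [cite: JansevanRensburgWhittington2013, §3.2 Theorem 8 (arXiv v4 p. 11)] -/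
theorem abs_e_le {B ρ : ℝ} (hB : 0 ≤ B) (hρ : 0 < ρ)
    (hN : ∀ c, (∑ n ∈ Finset.range (2 * c + 2), (N c n : ℝ)) ≤ B * ρ ^ c) (k : ℕ) :
    |((e N k : ℤ) : ℝ)| ≤ 3 ^ (k + 1) * (16 * ρ * (B + 1)) ^ k := abs_coeff_E_le N hB hρ hN k k

/-- ★★★ **The inverse expansion converges (generic)**: under the hypotheses of `expansion`, for
`0 < t ≤ min t₀ (1/(400ρ(B+1)))`, `Σ_k e_k t^k = 1/u(t)`. [cite: JansevanRensburgWhittington2013, §3.2 Theorem 8 (arXiv v4 p. 11)] -/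
theorem hasSum_e_inv {B ρ t₀ : ℝ} {u : ℝ → ℝ} (hB : 0 ≤ B) (hρ : 0 < ρ)
    (hN : ∀ c, (∑ n ∈ Finset.range (2 * c + 2), (N c n : ℝ)) ≤ B * ρ ^ c) (hP0 : ∀ x, P N 0 x = x)
    (hmem : ∀ t ∈ Set.Ioc 0 t₀, u t ∈ Set.Icc (0 : ℝ) 1)
    (heq : ∀ t ∈ Set.Ioc 0 t₀, HasSum (fun c => t ^ c * P N c (u t)) 1)
    {t : ℝ} (ht : t ∈ Set.Ioc 0 (min t₀ (1 / (400 * ρ * (B + 1))))) :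
    HasSum (fun k => (e N k : ℝ) * t ^ k) (u t)⁻¹ := by
  have ht0 : 0 < t := ht.1
  have htt₀ : t ≤ t₀ := ht.2.trans (min_le_left _ _)
  have ht400 : t ≤ 1 / (400 * ρ * (B + 1)) := ht.2.trans (min_le_right _ _)
  have ht96 : t ≤ 1 / (96 * ρ * (B + 1)) :=
    ht400.trans (div_le_div_of_nonneg_left (by norm_num) (by positivity) (by nlinarith [hρ, hB]))
  have hR0 : 0 < 16 * ρ * (B + 1) := by positivity
  have hRt : 3 * (16 * ρ * (B + 1) * t) ≤ 1 / 2 := by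
    have := mul_le_mul_of_nonneg_left ht96 hR0.le
    rw [show 16 * ρ * (B + 1) * (1 / (96 * ρ * (B + 1))) = (1 : ℝ) / 6 by field_simp; ring] at this
    linarith
  -- |1 − u| ≤ 1/2 + Bρt via K = 1:  A_1(t) = 1 − t P_1(1), |u − A_1| ≤ 1/2
  have hcontr := abs_sub_ev_A_le_half_pow N hB hρ hN hP0 hmem heq ht
  obtain ⟨hu0, hu1⟩ := hmem t ⟨ht0, htt₀⟩
  have hBρt : B * ρ * t ≤ 1 / 400 := by
    have h1 : B * ρ * t ≤ B * ρ * (1 / (400 * ρ * (B + 1))) := mul_le_mul_of_nonneg_left ht400 (by positivity)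
    have h2 : B * ρ * (1 / (400 * ρ * (B + 1))) = B / (B + 1) / 400 := by field_simp
    have h3 : B / (B + 1) ≤ 1 := by rw [div_le_one (by positivity)]; linarith
    rw [h2] at h1; linarith
  have hA1 : ev (A N 1) t = 1 - t * P N 1 1 := by
    rw [ev_A_succZ, Finset.sum_range_one, ev_A_zeroZ]; ring
  have hP1 : P N 1 1 ≤ B * ρ := by
    have := P_le_sumZ N (c := 1) (x := 1) zero_le_one le_rfl
    exact this.trans (by simpa using hN 1)
  have hP10 : 0 ≤ P N 1 1 := by unfold P; exact Finset.sum_nonneg fun n _ => by positivity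
  have h1u : |1 - u t| ≤ 1 / 2 + 1 / 400 := by
    have hK1 := hcontr 1
    rw [hA1, pow_one] at hK1
    have : |1 - u t| ≤ |u t - (1 - t * P N 1 1)| + t * P N 1 1 := by
      rw [abs_sub_comm (u t)]
      calc |1 - u t| = |(1 - t * P N 1 1 - u t) + t * P N 1 1| := by ring_nf
        _ ≤ |1 - t * P N 1 1 - u t| + |t * P N 1 1| := abs_add_le _ _
        _ = |1 - t * P N 1 1 - u t| + t * P N 1 1 := by rw [abs_of_nonneg (mul_nonneg ht0.le hP10)]
    nlinarith [mul_le_mul_of_nonneg_left hP1 ht0.le]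
  have hu_lo : 49 / 100 ≤ u t := by have := abs_le.1 h1u; linarith
  -- summability by the geometric bound on e_k
  have hsum : Summable fun k => (e N k : ℝ) * t ^ k := by
    refine Summable.of_norm_bounded (g := fun k => 3 * (1 / 2 : ℝ) ^ k) ((summable_geometric_of_lt_one (by norm_num)
      (by norm_num)).mul_left 3) fun k => ?_
    rw [Real.norm_eq_abs, abs_mul, abs_pow, abs_of_pos ht0]
    have h1 := abs_e_le N hB hρ hN k
    calc |((e N k : ℤ) : ℝ)| * t ^ k ≤ 3 ^ (k + 1) * (16 * ρ * (B + 1)) ^ k * t ^ k := mul_le_mul_of_nonneg_right h1 (by positivity)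
      _ = 3 * (3 * (16 * ρ * (B + 1) * t)) ^ k := by rw [pow_succ, mul_pow 3, mul_pow (16 * ρ * (B + 1)) t]; ring
      _ ≤ 3 * (1 / 2) ^ k := mul_le_mul_of_nonneg_left (pow_le_pow_left₀ (by positivity) hRt _) (by norm_num)
  rw [hsum.hasSum_iff_tendsto_nat]
  -- distance bound for K ≥ 3
  have hbound : ∀ K : ℕ, 3 ≤ K → dist (∑ k ∈ Finset.range (K + 1), (e N k : ℝ) * t ^ k) (u t)⁻¹ ≤ 12 * (3 / 4) ^ K := by
    intro K hK
    set a := ev (A N K) t with ha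
    have hK1 := hcontr K
    rw [← ha] at hK1
    have hhalf : (1 / 2 : ℝ) ^ K ≤ 1 / 8 := by
      calc (1 / 2 : ℝ) ^ K ≤ (1 / 2) ^ 3 := pow_le_pow_of_le_one (by norm_num) (by norm_num) hK
        _ = 1 / 8 := by norm_num
    have hua : |u t - a| ≤ 1 / 8 := hK1.trans hhalf
    have ha3 : 1 / 3 ≤ a := by have := abs_le.1 hua; linarith
    have ha0 : 0 < a := by linarith
    have hu0' : 0 < u t := by linarith
    have h1 : |(u t)⁻¹ - a⁻¹| ≤ 7 * (1 / 2) ^ K := by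
      rw [inv_sub_inv hu0'.ne' ha0.ne', abs_div, abs_mul, abs_of_pos hu0', abs_of_pos ha0, abs_sub_comm, div_le_iff₀ (mul_pos hu0' ha0)]
      calc |u t - a| ≤ (1 / 2) ^ K := hK1
        _ ≤ 7 * (1 / 2) ^ K * (49 / 100 * (1 / 3)) := by nlinarith [pow_pos (show (0:ℝ) < 1/2 by norm_num) K]
        _ ≤ 7 * (1 / 2) ^ K * (u t * a) :=
            mul_le_mul_of_nonneg_left (mul_le_mul hu_lo ha3 (by norm_num) hu0'.le) (by positivity)
    have hE : ev (E N K) t = ∑ j ∈ Finset.range (K + 1), (1 - a) ^ j := ev_EZ N K t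
    have hgeom : a * ∑ j ∈ Finset.range (K + 1), (1 - a) ^ j = 1 - (1 - a) ^ (K + 1) := by
      have := mul_neg_geom_sum (1 - a) (K + 1)
      rwa [sub_sub_cancel] at this
    have h1a : |1 - a| ≤ 3 / 4 := by
      calc |1 - a| = |(1 - u t) + (u t - a)| := by ring_nf
        _ ≤ |1 - u t| + |u t - a| := abs_add_le _ _
        _ ≤ (1 / 2 + 1 / 400) + 1 / 8 := add_le_add h1u hua
        _ ≤ 3 / 4 := by norm_num
    have h2 : |a⁻¹ - ev (E N K) t| ≤ 3 * (3 / 4) ^ (K + 1) := by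
      have heq2 : a⁻¹ - ev (E N K) t = (1 - a) ^ (K + 1) / a := by
        rw [hE, eq_div_iff ha0.ne', sub_mul, inv_mul_cancel₀ ha0.ne', mul_comm, hgeom]; ring
      rw [heq2, abs_div, abs_of_pos ha0, abs_pow, div_le_iff₀ ha0]
      calc |1 - a| ^ (K + 1) ≤ (3 / 4) ^ (K + 1) := pow_le_pow_left₀ (abs_nonneg _) h1a _
        _ = 3 * (3 / 4) ^ (K + 1) * (1 / 3) := by ring
        _ ≤ 3 * (3 / 4) ^ (K + 1) * a := mul_le_mul_of_nonneg_left ha3 (by positivity)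
    have h3 := abs_ev_E_sub_sum_leZ N hB hρ hN ht0.le ht96 K
    have hstab : ∑ k ∈ Finset.range (K + 1), ((E N K).coeff k : ℝ) * t ^ k = ∑ k ∈ Finset.range (K + 1), (e N k : ℝ) * t ^ k :=
      Finset.sum_congr rfl fun k hk => by rw [coeff_E_eq_e N (Nat.lt_succ_iff.1 (Finset.mem_range.1 hk))]
    rw [hstab] at h3
    rw [Real.dist_eq, abs_sub_comm]
    have hp1 : (1 / 2 : ℝ) ^ K ≤ (3 / 4) ^ K := pow_le_pow_left₀ (by norm_num) (by norm_num) K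
    calc |(u t)⁻¹ - ∑ k ∈ Finset.range (K + 1), (e N k : ℝ) * t ^ k|
        = |((u t)⁻¹ - a⁻¹) + (a⁻¹ - ev (E N K) t) + (ev (E N K) t - ∑ k ∈ Finset.range (K + 1), (e N k : ℝ) * t ^ k)| := by
          congr 1; ring
      _ ≤ |(u t)⁻¹ - a⁻¹| + |a⁻¹ - ev (E N K) t| + |ev (E N K) t - ∑ k ∈ Finset.range (K + 1), (e N k : ℝ) * t ^ k| :=
          (abs_add_le _ _).trans (add_le_add (abs_add_le _ _) le_rfl)
      _ ≤ 7 * (1 / 2) ^ K + 3 * (3 / 4) ^ (K + 1) + 2 * (1 / 2) ^ (K + 1) := add_le_add (add_le_add h1 h2) h3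
      _ ≤ 12 * (3 / 4) ^ K := by rw [pow_succ, pow_succ]; nlinarith [pow_pos (show (0:ℝ) < 3/4 by norm_num) K]
  refine Metric.tendsto_atTop.2 fun ε hε => ?_
  obtain ⟨n₀, hn₀⟩ := exists_pow_lt_of_lt_one (show 0 < ε / 12 by positivity) (show (3 / 4 : ℝ) < 1 by norm_num)
  refine ⟨n₀ + 4, fun n hn => ?_⟩
  obtain ⟨K, rfl⟩ : ∃ K, n = K + 1 := ⟨n - 1, by omega⟩
  have h1 := hbound K (by omega)
  have h2 : (3 / 4 : ℝ) ^ K ≤ (3 / 4) ^ n₀ := pow_le_pow_of_le_one (by norm_num) (by norm_num) (by omega)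
  linarith

/-- `e_0 = 1` (the leading term of the expansion is `y`). [cite: JansevanRensburgWhittington2013, §3.2 Theorem 8 (arXiv v4 p. 11)] -/
theorem e_zero : e N 0 = 1 := by
  simp [e, E, A]

end CostSeries

/-! ### The pulled walk on `ℤ^{d+1}`: the convergent expansion with integer coefficients, every dimension -/

/-- THE expansion coefficients of the pulled free energy on `ℤ^{d+1}`: `c^{(d)}_k := e_k` for the cost data of `ℤ^{d+1}`.
[cite: JansevanRensburgWhittington2013, §3.2 Theorem 8 (arXiv v4 p. 11)] -/
def largeForceCoeffZd (d k : ℕ) : ℤ := CostSeries.e (costCoeffZd d) k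

/-- `c^{(d)}_0 = 1` (leading term `y`). [cite: JansevanRensburgWhittington2013, §3.2 Theorem 8 (arXiv v4 p. 11)] -/
theorem largeForceCoeffZd_zero (d : ℕ) : largeForceCoeffZd d 0 = 1 := CostSeries.e_zero _

/-- `c_1 = #(1-step SAWs)` as a real number. [cite: MadrasSlade1993, §1.2] -/
def kappaZd (d : ℕ) : ℝ := (count (d + 1) 1 : ℝ)

/-- The cost-class bound on `ℤ^{d+1}`: `Σ_{n<2c+2} N_{c,n} ≤ 2κ(2κ²)^c`, `κ = c_1(ℤ^{d+1})`. [cite: MadrasSlade1993, §1.2] -/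
theorem sum_costCoeffZd_le (d c : ℕ) :
    (∑ n ∈ Finset.range (2 * c + 2), (costCoeffZd d c n : ℝ)) ≤ 2 * kappaZd d * (2 * kappaZd d ^ 2) ^ c := by
  have hκ : 1 ≤ kappaZd d := by unfold kappaZd; exact_mod_cast one_le_count (d + 1) 1
  have hterm : ∀ n ∈ Finset.range (2 * c + 2), (costCoeffZd d c n : ℝ) ≤ kappaZd d ^ (2 * c + 1) := by
    intro n hn
    have hn' : n ≤ 2 * c + 1 := by have := Finset.mem_range.1 hn; omega
    calc (costCoeffZd d c n : ℝ) ≤ (count (d + 1) n : ℝ) := by exact_mod_cast costCoeffZd_le_count d c n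
      _ ≤ (count (d + 1) 1 : ℝ) ^ n := count_le_count_one_pow d n
      _ = kappaZd d ^ n := rfl
      _ ≤ kappaZd d ^ (2 * c + 1) := pow_le_pow_right₀ hκ hn'
  calc (∑ n ∈ Finset.range (2 * c + 2), (costCoeffZd d c n : ℝ))
      ≤ ∑ _n ∈ Finset.range (2 * c + 2), kappaZd d ^ (2 * c + 1) := Finset.sum_le_sum hterm
    _ = (2 * c + 2 : ℕ) * kappaZd d ^ (2 * c + 1) := by rw [Finset.sum_const, Finset.card_range, nsmul_eq_mul]
    _ ≤ 2 ^ (c + 1) * kappaZd d ^ (2 * c + 1) := by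
        refine mul_le_mul_of_nonneg_right ?_ (by positivity)
        have : ∀ m : ℕ, (2 * m + 2 : ℕ) ≤ 2 ^ (m + 1) := by
          intro m
          induction m with
          | zero => norm_num
          | succ k ih =>
            have h2 : 2 ^ 1 ≤ 2 ^ (k + 1) := Nat.pow_le_pow_right (by norm_num) (by omega)
            calc 2 * (k + 1) + 2 = (2 * k + 2) + 2 := by ring
              _ ≤ 2 ^ (k + 1) + 2 ^ (k + 1) := by omega
              _ = 2 ^ (k + 1 + 1) := by ring
        exact_mod_cast this c
    _ = 2 * kappaZd d * (2 * kappaZd d ^ 2) ^ c := by rw [mul_pow]; ring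

/-- `P_0(x) = x` for the cost data of `ℤ^{d+1}`. [cite: MadrasSlade1993, §4.2, eq. (4.2.20)–(4.2.22) (p. 94, 2013 reprint)] -/
theorem P_costCoeffZd_zero (d : ℕ) (x : ℝ) : CostSeries.P (costCoeffZd d) 0 x = x := by
  simp [CostSeries.P, costCoeffZd_zero]

/-- The `t`-threshold for `ℤ^{d+1}`: `t₀ = 1/(μ³ + 1)` guarantees `μ³ < 1/t`. [cite: JansevanRensburgWhittington2013, §3.2 Theorem 8 (arXiv v4 p. 11)] -/
def tZeroZd (d : ℕ) : ℝ := 1 / (connectiveConstant (d + 1) ^ 3 + 1)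

/-- The radius (in `t = 1/y`) for `ℤ^{d+1}`: `t*_d = min t₀ (1/(400ρ(B+1)))`, `B = 2κ`, `ρ = 2κ²`.
[cite: JansevanRensburgWhittington2013, §3.2 Theorem 8 (arXiv v4 p. 11)] -/
def tStarZd (d : ℕ) : ℝ := min (tZeroZd d) (1 / (400 * (2 * kappaZd d ^ 2) * (2 * kappaZd d + 1)))

/-- `t*_d > 0`. [cite: JansevanRensburgWhittington2013, §3.2 Theorem 8 (arXiv v4 p. 11)] -/
theorem tStarZd_pos (d : ℕ) : 0 < tStarZd d := by
  have hκ : 1 ≤ kappaZd d := by unfold kappaZd; exact_mod_cast one_le_count (d + 1) 1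
  have hμ := connectiveConstant_pos (d + 1)
  unfold tStarZd tZeroZd
  exact lt_min (by positivity) (by positivity)

/-- Kesten's equation in `t` on `ℤ^{d+1}` for `0 < t ≤ t₀`. [cite: Beaton2015, Lemma 2] -/
theorem hasSum_costPoly_inv_zd (d : ℕ) {t : ℝ} (ht : t ∈ Set.Ioc 0 (tZeroZd d)) :
    HasSum (fun c => t ^ c * CostSeries.P (costCoeffZd d) c (largeForceUZd d t⁻¹)) 1 := by
  have hμ := connectiveConstant_pos (d + 1)
  have hy : connectiveConstant (d + 1) ^ 3 < t⁻¹ := by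
    have h1 : t ≤ 1 / (connectiveConstant (d + 1) ^ 3 + 1) := ht.2
    rw [le_div_iff₀ (by positivity)] at h1
    rw [lt_inv_comm₀ (by positivity) ht.1]
    calc t < 1 / connectiveConstant (d + 1) ^ 3 := by
          rw [lt_div_iff₀ (by positivity)]; nlinarith [ht.1, pow_pos hμ 3]
      _ = (connectiveConstant (d + 1) ^ 3)⁻¹ := one_div _
  have h := hasSum_costPoly_zd d hy
  refine h.congr_fun fun c => ?_
  rw [CostSeries.P, inv_pow, div_inv_eq_mul, mul_comm]

/-- ★★★★ **THE LARGE-FORCE EXPANSION ON `ℤ^{d+1}`, EVERY DIMENSION, CONVERGES**: for every `y ≥ 1/t*_d`,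
`e^{λ_B(y)} = Σ_{k=0}^{∞} c^{(d)}_k y^{1−k}` (`HasSum`) with integer coefficients `c^{(d)}_k = largeForceCoeffZd d k`, `c^{(d)}_0 = 1`.
[cite: JansevanRensburgWhittington2013, §3.2 Theorem 8 (arXiv v4 p. 11)] [cite: Beaton2015, Lemma 2] -/
theorem hasSum_largeForceCoeffZd (d : ℕ) {y : ℝ} (hy : (tStarZd d)⁻¹ ≤ y) :
    HasSum (fun k => y * ((largeForceCoeffZd d k : ℝ) * y⁻¹ ^ k)) (Real.exp (pulledBridgeFreeEnergy (d + 1) y)) := by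
  have hκ : 1 ≤ kappaZd d := by unfold kappaZd; exact_mod_cast one_le_count (d + 1) 1
  have hy0 : 0 < y := lt_of_lt_of_le (inv_pos.2 (tStarZd_pos d)) hy
  have ht0 : y⁻¹ ∈ Set.Ioc 0 (tStarZd d) := ⟨inv_pos.2 hy0, by rw [inv_le_comm₀ hy0 (tStarZd_pos d)]; exact hy⟩
  have ht : y⁻¹ ∈ Set.Ioc 0 (min (tZeroZd d) (1 / (400 * (2 * kappaZd d ^ 2) * (2 * kappaZd d + 1)))) := ht0
  have h := CostSeries.hasSum_e_inv (costCoeffZd d) (B := 2 * kappaZd d) (ρ := 2 * kappaZd d ^ 2) (t₀ := tZeroZd d)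
    (u := fun t => largeForceUZd d t⁻¹) (by positivity) (by positivity) (sum_costCoeffZd_le d) (P_costCoeffZd_zero d)
    (fun t ht' => ⟨(largeForceUZd_pos d (inv_pos.2 ht'.1)).le, largeForceUZd_le_one d (inv_pos.2 ht'.1)⟩)
    (fun t ht' => hasSum_costPoly_inv_zd d ht') ht
  have h2 := h.mul_left y
  simp only [inv_inv] at h2
  rw [exp_pulledBridgeFreeEnergy_eq_div_zd d hy0, div_eq_mul_inv]
  exact h2

/-- The same in `∃ / tsum` form. [cite: JansevanRensburgWhittington2013, §3.2 Theorem 8 (arXiv v4 p. 11)] -/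
theorem exp_pulledBridgeFreeEnergy_eq_tsum_zd (d : ℕ) :
    ∃ y₀ : ℝ, 0 < y₀ ∧ ∀ y ≥ y₀, (Summable fun k => y * ((largeForceCoeffZd d k : ℝ) * y⁻¹ ^ k)) ∧
      Real.exp (pulledBridgeFreeEnergy (d + 1) y) = ∑' k, y * ((largeForceCoeffZd d k : ℝ) * y⁻¹ ^ k) :=
  ⟨(tStarZd d)⁻¹, inv_pos.2 (tStarZd_pos d), fun _ hy =>
    ⟨(hasSum_largeForceCoeffZd d hy).summable, (hasSum_largeForceCoeffZd d hy).tsum_eq.symm⟩⟩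

/-- **Consistency with the `ℤ²` files**: for `d + 1 = 2` the coefficients of this file ARE `Zd.largeForceCoeff` (definitionally:
`Site (1+1) = Site 2`, `costZd 1 = cost`, `costCoeffZd 1 = costCoeff`, `E (costCoeffZd 1) k = largeForcePoly k`), hence the certified
values `1, 2, −2, 6, −20, 74, …` of the `ℤ²` chain are `c^{(1)}_0, c^{(1)}_1, …`. [cite: JansevanRensburgWhittington2013, §3.2 Theorem 8 (arXiv v4 p. 11)] -/
theorem largeForceCoeffZd_one (k : ℕ) : largeForceCoeffZd 1 k = largeForceCoeff k := rfl

/-- `u` of this file at `d + 1 = 2` is `Zd.largeForceU`. [cite: JansevanRensburgWhittington2013, §3.2 Theorem 8 (arXiv v4 p. 11)] -/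
theorem largeForceUZd_one (y : ℝ) : largeForceUZd 1 y = largeForceU y := rfl

end Literature.Probability.RandomPlanarGeometry.SAW.Zd
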